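import Summits.BirchSwinnertonDyer.BirchSwinnertonDyer.Theorems.GenusKolyvaginAtTwoGenusDeepSupplyAtTwoNegDiscNarrowDepthZeroInstance
import Summits.BirchSwinnertonDyer.BirchSwinnertonDyer.Theorems.GenusKolyvaginAtTwoPowDvdShaCardAtTwoPosTTranspositionReductionCriterion
import Literature.NumberTheory.EllipticCurves.GeomReductionFrobeniusProofs
import Literature.NumberTheory.EllipticCurves.ComplexMultiplicationDeuringReduction
import HarnessLib

/-!
# Route `GenusKolyvaginAtTwo`, supply cruxes 23491 / 25504, depth zero: AT A SILENT PRIME THE REDUCTION BIT IS IDENTICALLY TRIVIAL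
# (`y_K ≡` rational torsion mod `𝔓 ∣ ℓ` whenever `#Ẽ(𝔽_ℓ)[2] = 1`) — so the Δ>0 bit R₁⁺ (binder `hR1pos` of p762861) is VACUOUS

Seat `bsd-line-gk2-p5` g34 (cell `bsd-f1-sign2`, WIDTH-5 attach), `--supports stmt-BirchSwinnertonDyer-25504 --as helper`.  THEOREMS ONLY (no
definition, no named fact, no `sorry`); UNCONDITIONAL.  **BSD is NOT proved by this file and no item is closed by it.**  Memo
`HOME/line25504/R1POS-VACUOUS-gk2p5-g34.md` (evidence #7 on 25504).

The LEAD's depth-zero criterion (p761607) and its instantiation by gk2-p5 g33 (p762289, Claim A) say: at a prime `𝔓 ∣ ℓ`, `ℓ ∣ d_K` of good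
reduction, `2^M ∣ y_K` with `M ≥ 1` ⟹ `red_𝔓(e y_K) = red_𝔓(e s)` for an `Aut(K/ℚ)`-fixed torsion `s`.  The Δ>0 reduction bit R₁⁺
(`DepthZero.K1_pos_of_reductionBit`, p762538) asks for the NEGATION of that conclusion at some `ℓ ∣ d_K` — on the cell where the twin is ALL-SILENT
(`ord₂ c(Wd) = 0`, i.e. `#Ẽ(𝔽_ℓ)[2] = 1` at every `ℓ ∣ d_K`).  This file proves that at a SILENT prime the conclusion of Claim A holds WITHOUT ANY
DIVISIBILITY: the anti-invariant `y′ = y_K − s` reduces into `Ẽ[2]` (inertia), its reduction is fixed by an arithmetic Frobenius (which restricts to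
`1` or `τ` on `K`), and a Frobenius-fixed point of `red(E(ℚ̄))[2] = red(E[2])` comes from a Frobenius-fixed point of `E[2]`, which is `0` when
`#Ẽ_v(k_v)[2] = 1` (Silverman VII.3.1(b): `#{u ∈ E[2] : σ₀ u = u} = #Ẽ_v(k_v)[2]`, tree `FrobShape.exists_frobenius_natCard_fixed_eq`).

* §1 `exists_twoTorsion_geomReduction_eq` — `red : E[2] → Ẽ[2]` is ONTO for the tree's `geomReduction` at an odd good prime
  (injective by VII.3.1(b), `#E[2] = #Ẽ[2] = 4`).
* §2 `geomReduction_sub_half_eq_zero_of_frob` — the LEAD's kernel with `2 ∣ Y` REPLACED by «an arithmetic Frobenius `σ` at `𝔓` with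
  `σ Y ∈ {Y, −Y + t}`, `σ t = t`, fixing no non-zero `2`-torsion point»: then `red(Y − s) = 0`.
* §3 `geomReduction_heegnerPoint_eq_of_natCard_twoTorsion_reductionAt_eq_one` — `E(K)`-currency (twin of g33's
  `geomReduction_heegnerPoint_eq_of_two_pow_smul` with `(1 ≤ M, 2^M ∣ P)` replaced by `#Ẽ_v(k_v)[2] = 1`).
* §4 `reductionBit_fails_of_natCard_twoTorsion_reductionAt_eq_one` — the cruxes' currency: for EVERY lift `P₀ ↦ P(1)` there is an
  `Aut(K/ℚ)`-fixed torsion `s` with `red(e P₀) = red(e s)`; i.e. the bit of R₁/R₁⁺ FAILS at every silent ramified prime.  Since on the K₁⁺ cell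
  (all-silent twin) EVERY `ℓ ∣ d_K` is silent (`PlusDescent.forall_twoTorsion_padic_eq_zero_of_padicValNat_two_tamagawaProduct_twin_eq_zero` in the
  `ℚ_ℓ`-currency; `#E(ℚ_ℓ)[2] = #Ẽ(𝔽_ℓ)[2]` by Hensel), R₁⁺ can only hold on an EMPTY frame: do not itemise `hR1pos`; the Δ>0 depth-zero bit is
  archimedean (memo §3).  R₁ (Δ<0, where `#Sel₂` forces a DEF-1 prime) is not affected.

References: [SilvermanAEC2009] Prop. VII.3.1(b), Prop. VII.4.1(a), Cor. III.6.4(b); [Serre1972] §1.11 Prop. 11; [GrossLMS1991] §5 Prop. 5.3;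
[Darmon2004] Prop. 3.11; [Kramer1981] §2 Prop. 3.
-/

set_option autoImplicit false
set_option linter.dupNamespace false -- `Summit.<P>.<Sub>` repeats `BirchSwinnertonDyer` (D-0017)

noncomputable section

open scoped Classical NumberField Pointwise

namespace Summit.BirchSwinnertonDyer.BirchSwinnertonDyer.Theorems.GenusSupplyNarrow.DepthZeroSilent

open IsDedekindDomain Field NumberField WeierstrassCurve Literature.NumberTheory.EllipticCurves
  Literature.NumberTheory.EllipticCurves.ModularForms Literature.NumberTheory.GaloisRepresentations Rat.HeightOneSpectrum
  Summit.BirchSwinnertonDyer.BirchSwinnertonDyer.Theorems.GenusSupplyNarrow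
  Summit.BirchSwinnertonDyer.BirchSwinnertonDyer.Theorems.GenusSupplyNarrow.DepthZero

/-! ## §1 `red : E[2] → Ẽ[2]` is onto (odd good prime) -/

section Lift

variable {p : ℕ} [Fact p.Prime] {W : WeierstrassCurve ℚ} [W.IsGloballyMinimal] [W.IsElliptic]
  (hΔ : ¬ (p : ℤ) ∣ minimalDiscriminantInt W)

/-- **Every `2`-torsion point of `Ẽ(𝔽̄_p)` is the reduction of a `2`-torsion point of `E(ℚ̄)`** (`p` odd, good): `red` is injective on
`E[2]` (Silverman VII.3.1(b), tree `eq_zero_of_smul_eq_zero_of_geomReduction_eq_zero`) and `#E[2] = 4 = #Ẽ[2]` (III.6.4(b) for `E/ℚ̄` and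
for the elliptic curve `Ẽ/𝔽̄_p`), so `red : E[2] → Ẽ[2]` is a bijection. [cite: SilvermanAEC2009, Prop. VII.3.1(b) and Cor. III.6.4(b)] -/
theorem exists_twoTorsion_geomReduction_eq (hp2 : p ≠ 2) (X : (reductionModPrime W p).geomPoints) (hX : (2 : ℤ) • X = 0) :
    ∃ u : W.geomPoints, (2 : ℤ) • u = 0 ∧ geomReduction hΔ u = X := by
  haveI : Fact (Nat.Prime 2) := ⟨Nat.prime_two⟩
  haveI hE : (reductionModPrime W p).IsElliptic := isElliptic_reductionModPrime W hΔ
  have hp : p.Prime := Fact.out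
  have hpm : ¬ p ∣ 2 := fun h ↦ hp2 ((Nat.prime_dvd_prime_iff_eq hp Nat.prime_two).mp h)
  -- the restriction of `red` to `E[2] → Ẽ[2]`
  have hmapsTo : ∀ u : geomTorsion W ((2 : ℕ) : ℤ),
      geomReduction hΔ (u : W.geomPoints) ∈ geomTorsion (reductionModPrime W p) ((2 : ℕ) : ℤ) := fun u ↦ by
    have hu : ((2 : ℕ) : ℤ) • (u : W.geomPoints) = 0 := (Submodule.mem_torsionBy_iff _ _).mp u.2
    refine (Submodule.mem_torsionBy_iff _ _).mpr ?_
    change ((2 : ℕ) : ℤ) • geomReduction hΔ (u : W.geomPoints) = 0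
    rw [← map_zsmul, hu, map_zero]
  set f : geomTorsion W ((2 : ℕ) : ℤ) → geomTorsion (reductionModPrime W p) ((2 : ℕ) : ℤ) :=
    fun u ↦ ⟨geomReduction hΔ (u : W.geomPoints), hmapsTo u⟩ with hf
  have hinj : Function.Injective f := by
    intro u u' huu
    have hred : geomReduction hΔ ((u : W.geomPoints) - u') = 0 := by
      rw [map_sub, sub_eq_zero]
      exact congrArg Subtype.val huu
    have h0 : 2 • ((u : W.geomPoints) - u') = 0 := by
      have hu : ((2 : ℕ) : ℤ) • (u : W.geomPoints) = 0 := (Submodule.mem_torsionBy_iff _ _).mp u.2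
      have hu' : ((2 : ℕ) : ℤ) • (u' : W.geomPoints) = 0 := (Submodule.mem_torsionBy_iff _ _).mp u'.2
      rw [← natCast_zsmul, smul_sub, hu, hu', sub_zero]
    exact Subtype.ext (sub_eq_zero.mp (eq_zero_of_smul_eq_zero_of_geomReduction_eq_zero hΔ hpm h0 hred))
  -- cardinalities
  have hT : Nat.card (geomTorsion W ((2 : ℕ) : ℤ)) = 2 ^ 2 := card_torsionPoints_eq_sq_holds W (AlgebraicClosure ℚ) (by norm_num)
  have h2F : ((2 : ℕ) : AlgebraicClosure (ZMod p)) ≠ 0 := by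
    have h2z : ((2 : ℕ) : ZMod p) ≠ 0 := by
      rw [Ne, ZMod.natCast_eq_zero_iff]
      exact hpm
    rw [← map_natCast (algebraMap (ZMod p) (AlgebraicClosure (ZMod p))), map_ne_zero]
    exact h2z
  have hT' : Nat.card (geomTorsion (reductionModPrime W p) ((2 : ℕ) : ℤ)) = 2 ^ 2 :=
    card_torsionPoints_eq_sq_holds (reductionModPrime W p) (AlgebraicClosure (ZMod p)) h2F
  haveI : Finite (geomTorsion (reductionModPrime W p) ((2 : ℕ) : ℤ)) := Nat.finite_of_card_ne_zero (by rw [hT']; norm_num)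
  have hbij : Function.Bijective f := hinj.bijective_of_nat_card_le (by rw [hT, hT'])
  have hX' : X ∈ geomTorsion (reductionModPrime W p) ((2 : ℕ) : ℤ) :=
    (Submodule.mem_torsionBy_iff _ _).mpr (by exact_mod_cast hX)
  obtain ⟨u, hu⟩ := hbij.2 ⟨X, hX'⟩
  refine ⟨u, ?_, congrArg Subtype.val hu⟩
  exact_mod_cast ((Submodule.mem_torsionBy_iff _ _).mp u.2 : ((2 : ℕ) : ℤ) • (u : W.geomPoints) = 0)

end Lift

/-! ## §2 The kernel: a Frobenius fixing no non-zero `2`-torsion point replaces `2`-divisibility -/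

section Kernel

variable {p : ℕ} [Fact p.Prime] {W : WeierstrassCurve ℚ} [W.IsGloballyMinimal] [W.IsElliptic]
  (hΔ : ¬ (p : ℤ) ∣ minimalDiscriminantInt W)
  {𝔓 : Ideal (absIntegers (𝓞 ℚ) ℚ)}
  (hmem : ∀ x : absIntegers (𝓞 ℚ) ℚ, x ∈ 𝔓 ↔ (x : AlgebraicClosure ℚ) ∈ (placeOver p).nonunits)
  {γ : absoluteGaloisGroup ℚ} (hγ : γ ∈ 𝔓.inertia (absoluteGaloisGroup ℚ))

include hmem hγ in
/-- **THE SILENT-PRIME KERNEL.**  `p` odd good, `𝔓` the place's prime, `γ ∈ I_𝔓` with `γ • Y = −Y + t`, `γ • t = t`, `t` of odd order `m`,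
`s := ((m+1)/2)·t`; and an arithmetic Frobenius `σ` at `𝔓` with `σ • Y = Y` or `σ • Y = −Y + t`, `σ • t = t`, fixing no non-zero `2`-torsion
point of `E(ℚ̄)`.  Then **`red(Y − s) = 0`**: `2·red(Y − s) = 0` (LEAD kernel, inertia), `red(Y − s) = red u` with `u ∈ E[2]` (§1),
`Frob·red(Y − s) = red(σ(Y − s)) = ±red(Y − s) = red(Y − s)` (Serre), so `red(σu − u) = 0`, `σu = u` (VII.3.1(b)), `u = 0`.
[cite: Serre1972, §1.11, Prop. 11 (proof)] [cite: SilvermanAEC2009, Prop. VII.3.1(b)] [cite: GrossLMS1991, §5 Prop. 5.3] -/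
theorem geomReduction_sub_half_eq_zero_of_frob (hp2 : p ≠ 2) {Y t : W.geomPoints} (hY : γ • Y = -Y + t) (ht : γ • t = t)
    (hodd : Odd (addOrderOf t))
    {v : HeightOneSpectrum (𝓞 ℚ)} (hv : (primesEquiv v : ℕ) = p) (h𝔓 : 𝔓 ∈ v.primesAbove)
    {σ : absoluteGaloisGroup ℚ} (hσ : IsArithFrobAt (𝓞 ℚ) σ 𝔓)
    (hσY : σ • Y = Y ∨ σ • Y = -Y + t) (hσt : σ • t = t)
    (hfix : ∀ u : W.geomPoints, (2 : ℤ) • u = 0 → σ • u = u → u = 0) :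
    geomReduction hΔ (Y - (((addOrderOf t + 1) / 2 : ℕ) : ℤ) • t) = 0 := by
  have hp : p.Prime := Fact.out
  have hpm : ¬ p ∣ 2 := fun h ↦ hp2 ((Nat.prime_dvd_prime_iff_eq hp Nat.prime_two).mp h)
  have h2s := two_smul_half_of_odd_addOrderOf hodd
  set s : W.geomPoints := (((addOrderOf t + 1) / 2 : ℕ) : ℤ) • t with hs
  -- `2 • red (Y - s) = 0`
  have h2 : (2 : ℤ) • geomReduction hΔ (Y - s) = 0 := two_smul_geomReduction_sub_half_eq_zero (p := p) hΔ hmem hγ hY ht hodd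
  -- lift `red (Y - s)` to `u ∈ E[2]`
  obtain ⟨u, hu2, hu⟩ := exists_twoTorsion_geomReduction_eq hΔ hp2 _ h2
  -- the `p`-power Frobenius on `𝔽̄_p`
  obtain ⟨φ, hφ⟩ := exists_frobenius_absoluteGaloisGroup (ZMod p)
  have hφp : ∀ x : AlgebraicClosure (ZMod p), φ • x = x ^ p := fun x ↦ by rw [hφ x, Nat.card_zmod]
  have hσs : σ • s = s := by rw [hs, smul_zsmul_geomPoints', hσt]
  -- `red (σ • (Y - s)) = red (Y - s)`
  have hσY' : geomReduction hΔ (σ • (Y - s)) = geomReduction hΔ (Y - s) := by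
    rcases hσY with h | h
    · rw [smul_sub, h, hσs]
    · have hneg : σ • (Y - s) = -(Y - s) := by
        rw [smul_sub, h, hσs, neg_sub, sub_eq_iff_eq_add, ← h2s, two_smul]
        abel
      rw [hneg, map_neg]
      -- `- r = r` for `r + r = 0`
      have h2' : geomReduction hΔ (Y - s) + geomReduction hΔ (Y - s) = 0 := by rwa [two_smul] at h2
      exact (neg_eq_of_add_eq_zero_right h2').symm ▸ rfl
  have hφX : φ • geomReduction hΔ (Y - s) = geomReduction hΔ (Y - s) := by
    rw [← geomReduction_smul_of_isArithFrobAt hΔ hmem hv h𝔓 hσ hφp, hσY']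
  -- `red (σ • u - u) = 0`, hence `σ • u = u`, hence `u = 0`
  have hred : geomReduction hΔ (σ • u - u) = 0 := by
    rw [map_sub, geomReduction_smul_of_isArithFrobAt hΔ hmem hv h𝔓 hσ hφp u, hu, hφX, sub_self]
  have h2u : 2 • (σ • u - u) = 0 := by
    rw [← natCast_zsmul, smul_sub, ← smul_zsmul_geomPoints']
    push_cast
    rw [hu2, smul_zero, sub_zero]
  have hσu : σ • u - u = 0 := eq_zero_of_smul_eq_zero_of_geomReduction_eq_zero hΔ hpm h2u hred
  have hu0 : u = 0 := hfix u hu2 (sub_eq_zero.mp hσu)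
  rw [← hu, hu0, map_zero]

end Kernel

/-! ## §3 `E(K)`-currency: a Heegner point reduces into the rational torsion at every SILENT ramified prime -/

variable {K : Type} [Field K] [NumberField K]

/-- **CLAIM A WITHOUT DIVISIBILITY AT A SILENT PRIME.**  `W/ℚ` globally minimal of conductor `N`, `K` imaginary quadratic with the Heegner
hypothesis, `P ∈ E(K)` a Heegner point of level `N`, `w(E) = +1`, `E(K)[2] = 0`; `ℓ ∣ d_K` an odd prime of good reduction at which the reduction
has NO rational point of order `2` (`#Ẽ_v(k_v)[2] = 1`, `v` the place over `ℓ` — the silent case `c_ℓ(E^(d_K)) = 1`).  Then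
**`red_ℓ(e_* P) = red_ℓ(e_* s)` for some torsion point `s ∈ E(K)` fixed by `Aut(K/ℚ)`** — the conclusion of g33's
`geomReduction_heegnerPoint_eq_of_two_pow_smul` WITHOUT its hypothesis `2^M ∣ P`, `M ≥ 1`.  Proof: §2 at `A = e_*(E(K))`, `Y = e_* P`,
`t = e_*(τP + P)` (torsion by Gross 5.3 / Darmon 3.11, `w = +1`), `γ` the inertia element of g33's §1, `σ` a conjugate of the counting Frobenius
`σ₀` of `FrobShape.exists_frobenius_natCard_fixed_eq` moved to the place's prime (it fixes no non-zero point of `E[2]` because `σ₀` fixes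
`#Ẽ_v(k_v)[2] = 1` of them), `σ|_K ∈ {1, τ}`.  [cite: GrossLMS1991, §5 Prop. 5.3] [cite: Darmon2004, Prop. 3.11]
[cite: SilvermanAEC2009, Prop. VII.3.1(b)] [cite: Serre1972, §1.11, Prop. 11 (proof)] -/
theorem geomReduction_heegnerPoint_eq_of_natCard_twoTorsion_reductionAt_eq_one (W : WeierstrassCurve ℚ) [W.IsElliptic]
    [W.IsGloballyMinimal] [NeZero (W.conductorNorm ℤ)] (hK : IsImaginaryQuadratic K)
    (hH : SatisfiesHeegnerHypothesis (W.conductorNorm ℤ) K)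
    {P : (W.baseChange K).toAffine.Point} (hP : IsHeegnerPoint (W.conductorNorm ℤ) W K P) (hw1 : W.rootNumber = 1)
    (h2K : ∀ T : (W.baseChange K).toAffine.Point, (2 : ℤ) • T = 0 → T = 0)
    {ℓ : ℕ} [Fact ℓ.Prime] (hℓ2 : ℓ ≠ 2) (hℓ : (ℓ : ℤ) ∣ NumberField.discr K) (hΔ : ¬ (ℓ : ℤ) ∣ minimalDiscriminantInt W)
    {v : HeightOneSpectrum (𝓞 ℚ)} (hvℓ : (ℓ : 𝓞 ℚ) ∈ v.asIdeal)
    (h1 : Nat.card (AddSubgroup.torsionBy (W.reductionAt v).toAffine.Point ((2 : ℕ) : ℤ)) = 1) :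
    ∃ s : (W.baseChange K).toAffine.Point, IsOfFinAddOrder s ∧ (∀ σ : K ≃ₐ[ℚ] K, σ • s = s) ∧
      geomReduction hΔ (Affine.Point.map (W' := W) (absEmbedding ℚ K) P : W.geomPoints) =
        geomReduction hΔ (Affine.Point.map (W' := W) (absEmbedding ℚ K) s : W.geomPoints) := by
  haveI : Fact (Nat.Prime 2) := ⟨Nat.prime_two⟩
  have hℓp : ℓ.Prime := Fact.out
  have h2 : Module.finrank ℚ K = 2 := hK.1
  haveI : Algebra.IsQuadraticExtension ℚ K := ⟨h2⟩
  haveI : IsGalois ℚ K := inferInstance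
  have hcard : Nat.card (K ≃ₐ[ℚ] K) = 2 := by rw [IsGalois.card_aut_eq_finrank, h2]
  -- the place `v = ℓ`, the prime `𝔓` of the place of `ℚ̄` over `ℓ`, the inertia element
  have hv : (primesEquiv v : ℕ) = ℓ := primesEquiv_eq_of_natCast_mem hℓp hvℓ
  obtain ⟨𝔓, hmem, h𝔓⟩ := exists_ideal_placeOver (p := ℓ) hv
  obtain ⟨γ, hγI, τ, hτ1, hγ⟩ := exists_mem_inertia_smul_absEmbedding_eq h2 hℓ hv h𝔓
  have hττ : τ * τ = 1 := by
    rcases Literature.NumberTheory.QuadraticFields.eq_one_or_eq_of_card_eq_two hcard hτ1 (τ * τ) with h | h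
    · exact h
    · exact absurd (mul_left_cancel (a := τ) (h.trans (mul_one τ).symm)) hτ1
  -- an arithmetic Frobenius `σ` at `𝔓` fixing no non-zero point of `E[2]`
  have hgoodℓ : W.HasGoodReductionAtPrime ℓ := W.hasGoodReductionAtPrime_of_not_dvd ℓ hΔ
  obtain ⟨σ₀, 𝔓₀, h𝔓₀, hσ₀, hcount⟩ :=
    Summit.BirchSwinnertonDyer.Rank1Residual.GaloisImage.FrobShape.exists_frobenius_natCard_fixed_eq W 2 ℓ hℓ2 hgoodℓ hvℓ
  have hc1 := hcount 1
  rw [pow_one, h1] at hc1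
  have hfix₀ : ∀ Q : geomTorsion W ((2 : ℕ) : ℤ), σ₀ • Q = Q → Q = 0 := by
    intro Q hQ
    haveI : Finite {Q : geomTorsion W ((2 : ℕ) : ℤ) // σ₀ • Q = Q} := Nat.finite_of_card_ne_zero (by rw [hc1]; norm_num)
    have hsub := (Nat.card_eq_one_iff_unique.mp hc1).1
    have h0 : (⟨Q, hQ⟩ : {Q : geomTorsion W ((2 : ℕ) : ℤ) // σ₀ • Q = Q}) = ⟨0, smul_zero σ₀⟩ := Subsingleton.elim _ _
    exact congrArg Subtype.val h0
  obtain ⟨g, hg⟩ := IsDedekindDomain.HeightOneSpectrum.exists_smul_eq_of_mem_primesAbove_holds h𝔓₀ h𝔓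
  set σ : absoluteGaloisGroup ℚ := g * σ₀ * g⁻¹ with hσdef
  have hσ : IsArithFrobAt (𝓞 ℚ) σ 𝔓 := hg ▸ hσ₀.conj g
  have hfix : ∀ u : W.geomPoints, (2 : ℤ) • u = 0 → σ • u = u → u = 0 := by
    intro u hu2 hσu
    have hmemu : g⁻¹ • u ∈ geomTorsion W ((2 : ℕ) : ℤ) := by
      refine (Submodule.mem_torsionBy_iff _ _).mpr ?_
      change ((2 : ℕ) : ℤ) • (g⁻¹ • u) = 0
      rw [← smul_zsmul_geomPoints']
      push_cast
      rw [hu2, smul_zero]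
    have hσ₀u : σ₀ • (g⁻¹ • u) = g⁻¹ • u := by
      have h := congrArg (fun x ↦ g⁻¹ • x) hσu
      simp only [hσdef, mul_smul, inv_smul_smul] at h
      exact h
    have hQ : (⟨g⁻¹ • u, hmemu⟩ : geomTorsion W ((2 : ℕ) : ℤ)) = 0 := by
      refine hfix₀ _ (Subtype.ext ?_)
      rw [Literature.NumberTheory.EllipticCurves.AddSubgroup.torsionBy.coe_smul]
      exact hσ₀u
    have hgu : g⁻¹ • u = 0 := congrArg Subtype.val hQ
    have : u = g • (g⁻¹ • u) := (smul_inv_smul g u).symm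
    rw [this, hgu, smul_zero]
  -- `σ` restricts to `ρ ∈ Aut(K/ℚ) = {1, τ}`
  set ρ : K ≃ₐ[ℚ] K := absGaloisQuot ℚ K σ with hρdef
  have hρ : ∀ x : K, σ • absEmbedding ℚ K x = absEmbedding ℚ K (ρ x) := fun x ↦ by
    rw [hρdef, absEmbedding_absGaloisQuot_apply]
  -- the embedding `e_*` and its image `A`
  obtain ⟨e, he⟩ : ∃ e : (W.baseChange K).toAffine.Point →+ W.geomPoints,
      e = Affine.Point.map (W' := W) (absEmbedding ℚ K) := ⟨_, rfl⟩
  have heinj : Function.Injective e := by rw [he]; exact Affine.Point.map_injective (W' := W) _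
  have hequiv : ∀ R : (W.baseChange K).toAffine.Point, γ • e R = e (τ • R) := fun R ↦ by
    rw [he]; exact smul_eq_map_absEmbedding_smul W hγ R _ rfl
  have hequivσ : ∀ R : (W.baseChange K).toAffine.Point, σ • e R = e (ρ • R) := fun R ↦ by
    rw [he]; exact smul_eq_map_absEmbedding_smul W hρ R _ rfl
  have hA2 : ∀ R : (W.baseChange K).toAffine.Point, (2 : ℤ) • e R = 0 → e R = 0 := by
    intro R h
    have h' : e ((2 : ℤ) • R) = e 0 := by rw [map_zsmul, h, map_zero]
    rw [h2K R (heinj h'), map_zero]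
  -- Gross 5.3 / Darmon 3.11: `t₀ := τP + P` is torsion
  have hστ : (τ : K →ₐ[ℚ] K) ≠ AlgHom.id ℚ K := fun h ↦ hτ1 (AlgEquiv.ext fun x ↦ DFunLike.congr_fun h x)
  set t₀ : (W.baseChange K).toAffine.Point := τ • P + P with ht₀
  have ht₀fin : IsOfFinAddOrder t₀ := by
    have h := heegnerPoint_conj_add_rootNumber_smul.apply heegnerPoint_conj_add_rootNumber_smul_holds hK hH hP hστ
    rwa [hw1, one_smul, ← WeierstrassCurve.smul_def W K τ P] at h
  have hτP : τ • P = -P + t₀ := by rw [ht₀]; abel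
  have hτt₀ : τ • t₀ = t₀ := by
    rw [ht₀, smul_add, ← mul_smul, hττ, one_smul, add_comm]
  -- the kernel's hypotheses
  have hY : γ • e P = -e P + e t₀ := by rw [hequiv, hτP, map_add, map_neg]
  have ht : γ • e t₀ = e t₀ := by rw [hequiv, hτt₀]
  have hodd : Odd (addOrderOf (e t₀)) := by
    refine odd_addOrderOf_of_two_torsionFree (e.isOfFinAddOrder ht₀fin) fun k hk ↦ ?_
    rw [← map_nsmul] at hk ⊢
    exact hA2 _ hk
  have hρ1τ : ρ = 1 ∨ ρ = τ := Literature.NumberTheory.QuadraticFields.eq_one_or_eq_of_card_eq_two hcard hτ1 ρ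
  have hσY : σ • e P = e P ∨ σ • e P = -e P + e t₀ := by
    rcases hρ1τ with h | h
    · left; rw [hequivσ, h, one_smul]
    · right; rw [hequivσ, h, hτP, map_add, map_neg]
  have hσt : σ • e t₀ = e t₀ := by
    rcases hρ1τ with h | h
    · rw [hequivσ, h, one_smul]
    · rw [hequivσ, h, hτt₀]
  have hkey := geomReduction_sub_half_eq_zero_of_frob (p := ℓ) hΔ hmem hγI hℓ2 hY ht hodd hv h𝔓 hσ hσY hσt hfix
  -- the torsion point `s := (half) • t₀`
  set c : ℤ := (((addOrderOf (e t₀) + 1) / 2 : ℕ) : ℤ) with hc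
  have hsm : τ • (c • t₀) = c • (τ • t₀) := map_zsmul (DistribSMul.toAddMonoidHom _ τ) c t₀
  refine ⟨c • t₀, ht₀fin.zsmul, fun σ' ↦ ?_, ?_⟩
  · rcases Literature.NumberTheory.QuadraticFields.eq_one_or_eq_of_card_eq_two hcard hτ1 σ' with rfl | rfl
    · exact one_smul _ _
    · rw [hsm, hτt₀]
  · rw [map_sub, sub_eq_zero, ← map_zsmul e c t₀] at hkey
    rw [he] at hkey
    exact hkey

/-! ## §4 The cruxes' currency: the bit of R₁ / R₁⁺ FAILS at every silent ramified prime -/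

/-- **THE REDUCTION BIT FAILS AT A SILENT PRIME** (cruxes' currency, every lift).  Habitat-type hypotheses: `r_an(E) = 0` (`w(E) = +1`),
`ρ̄_{E,2}` onto and `d_K·Δ_E ∉ ℚ²` (so `E(K[1])[2] = 0`, Gross Lemma 4.3 at `2`), `K` a Heegner field, `d₁` a conductor-`1` Kolyvagin–Heegner datum
with `P(1) = y_K` the image of `P₀ ∈ E(K)`, `ℓ ∣ d_K` an odd good prime with `#Ẽ_v(k_v)[2] = 1`.  **Then `red_ℓ(e_* P₀) = red_ℓ(e_* s)` for some
`Aut(K/ℚ)`-fixed torsion point `s ∈ E(K)`** — the NEGATION of the bit required by R₁ (`DepthZero.K1_of_reductionBit`, p762355) / R₁⁺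
(`DepthZero.K1_pos_of_reductionBit`, p762538) at that `ℓ`, for every lift `P₀`.  On the K₁⁺ cell (Δ>0, `#Sel₂(E) = 1`, all-silent twin:
`ord₂ c(Wd) = 0`, hence `#E(ℚ_ℓ)[2] = 1` at EVERY `ℓ ∣ d_K` by `PlusDescent.forall_twoTorsion_padic_eq_zero_of_padicValNat_two_tamagawaProduct_twin_eq_zero`,
`= #Ẽ(𝔽_ℓ)[2]` by Hensel) this leaves NO prime at which R₁⁺'s bit could hold: R₁⁺ is vacuous (true only on an empty frame).
[cite: GrossLMS1991, §5 Prop. 5.3, §4 (4.1) and Lemma 4.3] [cite: SilvermanAEC2009, Prop. VII.3.1(b)] [cite: Serre1972, §1.11, Prop. 11] -/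
theorem reductionBit_fails_of_natCard_twoTorsion_reductionAt_eq_one (W : WeierstrassCurve ℚ) [W.IsElliptic] [W.IsGloballyMinimal]
    [NeZero (W.conductorNorm ℤ)] (hK : IsImaginaryQuadratic K) (hH : SatisfiesHeegnerHypothesis (W.conductorNorm ℤ) K)
    (hr0 : W.analyticRank = 0) (hρ : W.HasSurjectiveModNGaloisRep 2) (hsq : ¬ IsSquare ((NumberField.discr K : ℚ) * W.Δ))
    {ℓ : ℕ} [Fact ℓ.Prime] (hℓ2 : ℓ ≠ 2) (hℓ : (ℓ : ℤ) ∣ NumberField.discr K) (hΔ : ¬ (ℓ : ℤ) ∣ minimalDiscriminantInt W)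
    {v : HeightOneSpectrum (𝓞 ℚ)} (hvℓ : (ℓ : 𝓞 ℚ) ∈ v.asIdeal)
    (h1 : Nat.card (AddSubgroup.torsionBy (W.reductionAt v).toAffine.Point ((2 : ℕ) : ℤ)) = 1)
    (Dt : ModularParametrizationData W (W.conductorNorm ℤ)) (β : ℤ) (ι : K →+* ℂ) (d₁ : KolyvaginHeegnerData Dt β ι 1)
    {P₀ : (W.baseChange K).toAffine.Point}
    (hP₀ : Affine.Point.map (W' := W) (algebraMap K (ringClassField K ι 1)).toRatAlgHom P₀ = d₁.derivedPoint) :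
    ∃ s : (W.baseChange K).toAffine.Point, IsOfFinAddOrder s ∧ (∀ σ : K ≃ₐ[ℚ] K, σ • s = s) ∧
      geomReduction hΔ (Affine.Point.map (W' := W) (absEmbedding ℚ K) P₀ : W.geomPoints) =
        geomReduction hΔ (Affine.Point.map (W' := W) (absEmbedding ℚ K) s : W.geomPoints) := by
  -- `E(K[1])[2] = 0`, hence `E(K)[2] = 0`
  have htors : ∀ T : (W.baseChange (ringClassField K ι 1)).toAffine.Point, (2 : ℤ) • T = 0 → T = 0 := by
    intro T hT
    have h := GenusExact.torsionBy_two_ringClassField_eq_bot W hK ι one_ne_zero hρ hsq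
    have hT' : T ∈ AddSubgroup.torsionBy (W.baseChange (ringClassField K ι 1)).toAffine.Point ((2 : ℕ) : ℤ) :=
      (Submodule.mem_torsionBy_iff _ T).mpr (by exact_mod_cast hT)
    rw [h] at hT'
    exact (AddSubgroup.mem_bot).mp hT'
  set i : (W.baseChange K).toAffine.Point →+ (W.baseChange (ringClassField K ι 1)).toAffine.Point :=
    Affine.Point.map (W' := W) (algebraMap K (ringClassField K ι 1)).toRatAlgHom with hi
  have hiinj : Function.Injective i := Affine.Point.map_injective (W' := W) _
  have h2K : ∀ T : (W.baseChange K).toAffine.Point, (2 : ℤ) • T = 0 → T = 0 := by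
    intro T hT
    apply hiinj
    rw [map_zero]
    exact htors _ (by rw [← map_zsmul, hT, map_zero])
  -- `P₀` is a Heegner point
  obtain ⟨P₁, hP₁H, hP₁⟩ := heegnerSystem_exists_isHeegnerPoint_map_eq_derivedPoint_one
    (heegnerPointOfConductor_one_galoisConj_holds (W.conductorNorm ℤ) W K) hK hH d₁
  have hP₀H : IsHeegnerPoint (W.conductorNorm ℤ) W K P₀ := hiinj (hP₁.trans hP₀.symm) ▸ hP₁H
  -- `w(E) = +1`
  have hw1 : W.rootNumber = 1 := W.rootNumber_eq_one_of_even_analyticRank (by rw [hr0]; exact Even.zero)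
  exact geomReduction_heegnerPoint_eq_of_natCard_twoTorsion_reductionAt_eq_one W hK hH hP₀H hw1 h2K hℓ2 hℓ hΔ hvℓ h1

end Summit.BirchSwinnertonDyer.BirchSwinnertonDyer.Theorems.GenusSupplyNarrow.DepthZeroSilent

end
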